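/-
Copyright: public-audit package `pub-balaban` (b2b-balaban), seat pv09-g4. Released under Apache 2.0 like Mathlib.
-/
import Literature.MathematicalPhysics.QuantumFieldTheory.Balaban1983to89.B6LayerDimTwo

/-!
# B6, p. 245: the layer sentence decided in every dimension — tensorisation over the free coordinates of Δ′

Source under audit: T. Bałaban, *Propagators and renormalization transformations for lattice gauge theories.
II*, Commun. Math. Phys. **96** (1984) 223–250 [B6], proof of Lemma 2.4, p. 245.  Companion of
`B6Lemma24Kappa` (`LayerIneq d L κ`), `B6LayerRayleigh` (¬ `LayerIneq d L 1` for L ≥ 10) and `B6LayerDimTwo`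
(`LayerIneq 2 L κ ↔ PathIneq L κ`, `PathIneq L 1` for L ≤ 9).

## The printed sentence (verbatim, p. 245, between (2.126) and (2.127))

*"The terms in parentheses on the right-hand side can be written as L^{−2}⟨B, (Δ_{Δ′}^{L^{−1},N} +
Q′*_{Δ′}Q′_{Δ′})B⟩, where the operators are defined on a d − 1-dimensional lattice.  This quadratic form is
bounded from below by L^{−d−1} Σ_{x∈Δ′} |B_μ(x)|², hence"* [(2.127) follows].  (Same quotation as in
`B6LayerPoincare`, `B6LayerUpperBound`, `B6LayerRayleigh`, `B6LayerDimTwo`.)  The sentence is `LayerIneq d L 1`.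

## What this file proves (all [folklore]; nothing printed is asserted or used)

The "d − 1-dimensional lattice" operator on the face Δ′ ≅ [0, L)^{d−1} is the Neumann Laplacian of a product of
d − 1 paths P_L, and the layer inequality tensorises: it holds in dimension d + 1 as soon as it holds in dimension d
and on the path.  Concretely:

* `ScaledIneq d L κ` — the layer inequality with the powers of L cleared,
  `κ Σ_{Δ′} g² ≤ L · Σ_{b⊂Δ′} (g(b₊) − g(b₋))² + (Σ_{Δ′} g)² / L^{d−1}`, and `layerIneq_iff_scaled`
  (`LayerIneq d L κ ↔ ScaledIneq d L κ` for d, L ≥ 1).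
* `scaledIneq_succ` — THE INDUCTION STEP: `ScaledIneq d L κ → PathIneq L κ → ScaledIneq (d+1) L κ` (d, L ≥ 1).
  Proof: split off one free coordinate ν ≠ μ of the (d+1)-dimensional face (`Fin.insertNth` / `Fin.succAbove`);
  on every ν-fibre decompose g into its fibre mean A and the fluctuation (variance identity `sum_sq_eq_var_add`);
  the fluctuation is controlled by `PathIneq` on the fibre (`pathIneq_centered`), the fibre mean A — a function on
  the d-dimensional face — by `ScaledIneq d`, and the bond differences of A by those of g (Cauchy–Schwarz,
  `sq_sum_le_card_mul_sum_sq`); the face sums and the gradient form split exactly along the fibration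
  (`sum_face_split`, `gradSq_face_split`).
* `layerIneq_iff_pathIneq` — for every d ≥ 2 and L ≥ 1: **`LayerIneq d L κ ↔ PathIneq L κ`** (→ : the profile
  test functions of `B6LayerRayleigh` plus the constant test function; ← : induction from `B6LayerDimTwo`).
* `layerIneq_one_iff` — for every d ≥ 2 and every L: **`LayerIneq d L 1 ↔ L ≤ 9`**: the printed factor 1 of the
  p. 245 sentence holds exactly for L ≤ 9, in every dimension (SOS certificates of `B6LayerDimTwo` for L ≤ 9,
  the witnesses of `B6LayerRayleigh` for L ≥ 10).

## HONEST SCOPE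

Nothing printed is asserted: the sentence is refuted as printed (L ≥ 10) and certified for L ≤ 9; nothing is
said about the constant of (2.128) (printed 1/(12d²), numerically supported, unproved — census G-B6-09R), whose
derivation in print goes through this sentence.  The sharp constant `min 1 (4L sin²(π/2L))` is not formalised.
-/

namespace Literature.MathematicalPhysics.QuantumFieldTheory.Balaban1983to89.B6LayerTensor

open Finset
open B6Elimination (block mem_block)
open B6BondElimination (unitVec unitVec_apply add_unitVec_apply)
open B6FaceInterpolation (lastLayer bondsIn mem_lastLayer mem_bondsIn)
open B6LayerPoincare (gradSq)
open B6Lemma24Kappa (LayerIneq)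
open B6LayerUpperBound (sum_Ico_int_eq_sum_range)
open B6LayerRayleigh (layerIneq_rayleigh not_layerIneq_one_of_ten_le)
open B6LayerDimTwo (PathIneq layerIneq_two_iff layerIneq_two_one_iff layerIneq_len_zero)

variable {d L : ℕ}

/-! ## §1  The layer inequality with the powers of L cleared -/

/-- `ScaledIneq d L κ`: for every corner y, direction μ and g,
κ Σ_{Δ′} g² ≤ L · G(g) + (Σ_{Δ′} g)² / L^{d−1} (= `LayerIneq d L κ` multiplied by L^{d+1}). [folklore] -/
def ScaledIneq (d L : ℕ) (κ : ℝ) : Prop :=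
  ∀ (y : Fin d → ℤ) (μ : Fin d) (g : (Fin d → ℤ) → ℝ),
    κ * ∑ x ∈ lastLayer L y μ, g x ^ 2 ≤
      (L : ℝ) * gradSq g (lastLayer L y μ) + (∑ x ∈ lastLayer L y μ, g x) ^ 2 / (L : ℝ) ^ (d - 1)

/-- The rescaling: for d, L ≥ 1 the two forms are equivalent term by term. [folklore] -/
theorem scaled_iff_gen (hd : 1 ≤ d) (hL : 1 ≤ L) (κ S D T : ℝ) :
    κ * ((L : ℝ)⁻¹) ^ (d + 1) * S ≤ ((L : ℝ)⁻¹) ^ d * D + ((L : ℝ)⁻¹) ^ 2 * (((L : ℝ)⁻¹) ^ (d - 1) * T) ^ 2 ↔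
      κ * S ≤ (L : ℝ) * D + T ^ 2 / (L : ℝ) ^ (d - 1) := by
  obtain ⟨k, rfl⟩ : ∃ k, d = k + 1 := ⟨d - 1, by omega⟩
  have hL0 : (0 : ℝ) < L := by exact_mod_cast hL
  have hLk : (0 : ℝ) < (L : ℝ) ^ (k + 2) := by positivity
  rw [show k + 1 - 1 = k from Nat.add_sub_cancel k 1]
  have e1 : κ * ((L : ℝ)⁻¹) ^ (k + 1 + 1) * S = (κ * S) / (L : ℝ) ^ (k + 2) := by
    rw [show k + 1 + 1 = k + 2 by ring, inv_pow, div_eq_mul_inv]; ring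
  have e2 : ((L : ℝ)⁻¹) ^ (k + 1) * D + ((L : ℝ)⁻¹) ^ 2 * (((L : ℝ)⁻¹) ^ k * T) ^ 2 =
      ((L : ℝ) * D + T ^ 2 / (L : ℝ) ^ k) / (L : ℝ) ^ (k + 2) := by
    rw [eq_div_iff hLk.ne']
    simp only [inv_pow]
    field_simp
    ring
  rw [e1, e2, div_le_div_iff_of_pos_right hLk]

/-- `LayerIneq d L κ ↔ ScaledIneq d L κ` (d, L ≥ 1). [folklore] -/
theorem layerIneq_iff_scaled (hd : 1 ≤ d) (hL : 1 ≤ L) (κ : ℝ) : LayerIneq d L κ ↔ ScaledIneq d L κ := by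
  refine ⟨fun h y μ g => (scaled_iff_gen hd hL κ _ _ _).1 (h y μ g),
    fun h y μ g => (scaled_iff_gen hd hL κ _ _ _).2 (h y μ g)⟩

/-! ## §2  One-dimensional inputs: the centred path inequality and the variance identity -/

/-- Σ_{0≤a<L} c = L·c over the integer interval. [folklore] -/
theorem sum_Ico_const (L : ℕ) (c : ℝ) : ∑ _a ∈ Ico (0 : ℤ) (L : ℤ), c = (L : ℝ) * c := by
  rw [sum_const, Int.card_Ico, nsmul_eq_mul]
  simp

/-- The variance identity on a fibre: Σ v² = Σ (v − A)² + L·A² when L·A = Σ v. [folklore] -/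
theorem sum_sq_eq_var_add (L : ℕ) (v : ℤ → ℝ) (A : ℝ) (hA : (L : ℝ) * A = ∑ a ∈ Ico (0 : ℤ) (L : ℤ), v a) :
    ∑ a ∈ Ico (0 : ℤ) (L : ℤ), v a ^ 2 =
      ∑ a ∈ Ico (0 : ℤ) (L : ℤ), (v a - A) ^ 2 + (L : ℝ) * A ^ 2 := by
  have h : ∀ a, (v a - A) ^ 2 = v a ^ 2 - (2 * A) * v a + A ^ 2 := fun a => by ring
  simp only [h, sum_add_distrib, sum_sub_distrib, ← mul_sum, sum_Ico_const]
  rw [← hA]; ring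

/-- The centred form of `PathIneq`: κ Σ (v − v̄)² ≤ L Σ (v(a+1) − v(a))² with v̄ the fibre mean. [folklore] -/
theorem pathIneq_centered {κ : ℝ} (h : PathIneq L κ) (hL : 1 ≤ L) (v : ℤ → ℝ) :
    κ * ∑ a ∈ Ico (0 : ℤ) (L : ℤ), (v a - (∑ b ∈ Ico (0 : ℤ) (L : ℤ), v b) / (L : ℝ)) ^ 2 ≤
      (L : ℝ) * ∑ a ∈ Ico (0 : ℤ) (L : ℤ), (if a + 1 < (L : ℤ) then (v (a + 1) - v a) ^ 2 else 0) := by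
  have hL0 : (L : ℝ) ≠ 0 := by exact_mod_cast (show L ≠ 0 by omega)
  set m : ℝ := (∑ b ∈ Ico (0 : ℤ) (L : ℤ), v b) / (L : ℝ) with hm
  have key := h (fun a => v a - m)
  have hsum : ∑ a ∈ Ico (0 : ℤ) (L : ℤ), (v a - m) = 0 := by
    rw [sum_sub_distrib, sum_Ico_const, hm, mul_div_cancel₀ _ hL0, sub_self]
  have hdiff : ∀ a : ℤ, (if a + 1 < (L : ℤ) then (v (a + 1) - m - (v a - m)) ^ 2 else 0) =
      (if a + 1 < (L : ℤ) then (v (a + 1) - v a) ^ 2 else 0) := fun a => by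
    split_ifs
    · ring
    · rfl
  simp only [hsum, hdiff] at key
  simpa using key

/-! ## §3  Splitting off one free coordinate of the face -/

/-- Insert the value a as the ν-th coordinate of x′ ∈ Z^d (= `Fin.insertNth`). [folklore] -/
def ins (ν : Fin (d + 1)) (a : ℤ) (x' : Fin d → ℤ) : Fin (d + 1) → ℤ :=
  Fin.insertNth (α := fun _ => ℤ) ν a x'

/-- Delete the ν-th coordinate (= `Fin.removeNth`). [folklore] -/
def rem (ν : Fin (d + 1)) (x : Fin (d + 1) → ℤ) : Fin d → ℤ := fun j => x (ν.succAbove j)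

/-- (ins ν a x′)_ν = a. [folklore] -/
@[simp] theorem ins_apply_same (ν : Fin (d + 1)) (a : ℤ) (x' : Fin d → ℤ) : ins ν a x' ν = a := by
  simp [ins]

/-- (ins ν a x′)_{ν.succAbove j} = x′_j. [folklore] -/
@[simp] theorem ins_apply_succAbove (ν : Fin (d + 1)) (a : ℤ) (x' : Fin d → ℤ) (j : Fin d) :
    ins ν a x' (ν.succAbove j) = x' j := by
  simp [ins]

/-- rem ν (ins ν a x′) = x′. [folklore] -/
@[simp] theorem rem_ins (ν : Fin (d + 1)) (a : ℤ) (x' : Fin d → ℤ) : rem ν (ins ν a x') = x' := by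
  ext j; simp [rem]

/-- ins ν (x ν) (rem ν x) = x. [folklore] -/
theorem ins_rem (ν : Fin (d + 1)) (x : Fin (d + 1) → ℤ) : ins ν (x ν) (rem ν x) = x := by
  have : rem ν x = Fin.removeNth ν x := rfl
  rw [ins, this, Fin.insertNth_self_removeNth]

/-- ins ν a x′ + e_ν = ins ν (a + 1) x′. [folklore] -/
theorem ins_add_unitVec_same (ν : Fin (d + 1)) (a : ℤ) (x' : Fin d → ℤ) :
    ins ν a x' + unitVec ν = ins ν (a + 1) x' := by
  rw [← ins_rem ν (ins ν a x' + unitVec ν)]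
  congr 1
  · simp [unitVec_apply]
  · ext j; simp [rem, unitVec_apply, Fin.succAbove_ne]

/-- ins ν a x′ + e_{ν.succAbove j} = ins ν a (x′ + e_j). [folklore] -/
theorem ins_add_unitVec_succAbove (ν : Fin (d + 1)) (a : ℤ) (x' : Fin d → ℤ) (j : Fin d) :
    ins ν a x' + unitVec (ν.succAbove j) = ins ν a (x' + unitVec j) := by
  rw [← ins_rem ν (ins ν a x' + unitVec (ν.succAbove j))]
  congr 1
  · simp [unitVec_apply, Fin.ne_succAbove]
  · ext i; simp [rem, unitVec_apply]

/-- Membership in the (d+1)-dimensional face along the fibration: x ∈ Δ′(y, μ) iff rem ν x lies in the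
d-dimensional face Δ′(rem ν y, μ′) and y_ν ≤ x_ν < y_ν + L (μ = ν.succAbove μ′). [folklore] -/
theorem mem_face_iff {ν μ : Fin (d + 1)} {μ' : Fin d} (hμ : ν.succAbove μ' = μ) {y x : Fin (d + 1) → ℤ} :
    x ∈ lastLayer L y μ ↔ rem ν x ∈ lastLayer L (rem ν y) μ' ∧ y ν ≤ x ν ∧ x ν < y ν + L := by
  rw [mem_lastLayer, mem_lastLayer, mem_block, mem_block, Fin.forall_iff_succAbove ν, ← hμ]
  simp only [rem]
  tauto

/-- ins ν (y_ν + a) x′ ∈ Δ′(y, μ) iff x′ ∈ Δ′(rem ν y, μ′) and 0 ≤ a < L. [folklore] -/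
theorem ins_mem_face_iff {ν μ : Fin (d + 1)} {μ' : Fin d} (hμ : ν.succAbove μ' = μ) {y : Fin (d + 1) → ℤ}
    {x' : Fin d → ℤ} {a : ℤ} :
    ins ν (y ν + a) x' ∈ lastLayer L y μ ↔ x' ∈ lastLayer L (rem ν y) μ' ∧ a ∈ Ico (0 : ℤ) (L : ℤ) := by
  rw [mem_face_iff hμ, rem_ins, ins_apply_same, mem_Ico]
  constructor
  · rintro ⟨h1, h2, h3⟩; exact ⟨h1, by omega, by omega⟩
  · rintro ⟨h1, h2, h3⟩; exact ⟨h1, by omega, by omega⟩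

/-- The face sum along the fibration: Σ_{x∈Δ′(y,μ)} F(x) = Σ_{x′∈Δ′(rem ν y, μ′)} Σ_{0≤a<L} F(ins ν (y_ν + a) x′).
[folklore] -/
theorem sum_face_split {ν μ : Fin (d + 1)} {μ' : Fin d} (hμ : ν.succAbove μ' = μ) (y : Fin (d + 1) → ℤ)
    (F : (Fin (d + 1) → ℤ) → ℝ) :
    ∑ x ∈ lastLayer L y μ, F x =
      ∑ x' ∈ lastLayer L (rem ν y) μ', ∑ a ∈ Ico (0 : ℤ) (L : ℤ), F (ins ν (y ν + a) x') := by
  rw [← sum_product' (f := fun x' a => F (ins ν (y ν + a) x'))]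
  refine sum_nbij' (fun x => (rem ν x, x ν - y ν)) (fun p => ins ν (y ν + p.2) p.1) ?_ ?_ ?_ ?_ ?_
  · intro x hx
    rw [mem_face_iff hμ] at hx
    rw [mem_product, mem_Ico]
    exact ⟨hx.1, by omega, by omega⟩
  · intro p hp
    rw [mem_product] at hp
    exact (ins_mem_face_iff hμ).2 hp
  · intro x hx
    simp only
    rw [show y ν + (x ν - y ν) = x ν by ring, ins_rem]
  · intro p hp
    simp only [rem_ins, ins_apply_same]
    ext <;> simp
  · intro x hx
    simp only
    rw [show y ν + (x ν - y ν) = x ν by ring, ins_rem]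


/-! ## §4  The gradient form along the fibration -/

/-- The ν-bonds of the (d+1)-dimensional face: Σ over b = ⟨x, x + e_ν⟩ ⊂ Δ′ equals the sum over the d-dimensional
face of the path energies of the fibres. [folklore] -/
theorem gradSq_nu_part {ν μ : Fin (d + 1)} {μ' : Fin d} (hμ : ν.succAbove μ' = μ) (y : Fin (d + 1) → ℤ)
    (g : (Fin (d + 1) → ℤ) → ℝ) :
    ∑ b ∈ (bondsIn (lastLayer L y μ)).filter (fun b => b.2 = ν), (g (b.1 + unitVec b.2) - g b.1) ^ 2 =
      ∑ x' ∈ lastLayer L (rem ν y) μ', ∑ a ∈ Ico (0 : ℤ) (L : ℤ),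
        (if a + 1 < (L : ℤ) then (g (ins ν (y ν + (a + 1)) x') - g (ins ν (y ν + a) x')) ^ 2 else 0) := by
  have hR : ∀ x' ∈ lastLayer L (rem ν y) μ', ∑ a ∈ Ico (0 : ℤ) (L : ℤ),
      (if a + 1 < (L : ℤ) then (g (ins ν (y ν + (a + 1)) x') - g (ins ν (y ν + a) x')) ^ 2 else 0) =
      ∑ a ∈ (Ico (0 : ℤ) (L : ℤ)).filter (fun a => a + 1 < (L : ℤ)),
        (g (ins ν (y ν + (a + 1)) x') - g (ins ν (y ν + a) x')) ^ 2 := fun x' _ => (sum_filter _ _).symm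
  rw [sum_congr rfl hR, ← sum_product' (f := fun x' a => (g (ins ν (y ν + (a + 1)) x') - g (ins ν (y ν + a) x')) ^ 2)]
  refine sum_nbij' (fun b => (rem ν b.1, b.1 ν - y ν)) (fun p => (ins ν (y ν + p.2) p.1, ν)) ?_ ?_ ?_ ?_ ?_
  · intro b hb
    rw [mem_filter, mem_bondsIn] at hb
    obtain ⟨⟨h1, h2⟩, h3⟩ := hb
    rw [h3] at h2
    rw [mem_face_iff hμ] at h1 h2
    have e : (b.1 + unitVec ν) ν = b.1 ν + 1 := by simp [unitVec_apply]
    rw [e] at h2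
    rw [mem_product, mem_filter, mem_Ico]
    exact ⟨h1.1, ⟨by omega, by omega⟩, by simp only; omega⟩
  · intro p hp
    rw [mem_product, mem_filter, mem_Ico] at hp
    obtain ⟨h1, ⟨h2, h3⟩, h4⟩ := hp
    rw [mem_filter, mem_bondsIn]
    refine ⟨⟨(ins_mem_face_iff hμ).2 ⟨h1, mem_Ico.2 ⟨h2, h3⟩⟩, ?_⟩, rfl⟩
    simp only
    rw [ins_add_unitVec_same, show y ν + p.2 + 1 = y ν + (p.2 + 1) by ring]
    exact (ins_mem_face_iff hμ).2 ⟨h1, mem_Ico.2 ⟨by omega, h4⟩⟩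
  · intro b hb
    rw [mem_filter] at hb
    simp only
    rw [show y ν + (b.1 ν - y ν) = b.1 ν by ring, ins_rem, ← hb.2]
  · intro p hp
    simp only [rem_ins, ins_apply_same]
    ext <;> simp
  · intro b hb
    rw [mem_filter] at hb
    simp only
    rw [show y ν + (b.1 ν - y ν + 1) = b.1 ν + 1 by ring, show y ν + (b.1 ν - y ν) = b.1 ν by ring, ins_rem]
    congr 2
    rw [hb.2, ← ins_add_unitVec_same, ins_rem]

/-- The transverse bonds of the (d+1)-dimensional face: Σ over b = ⟨x, x + e_j⟩ ⊂ Δ′, j ≠ ν, equals the sum over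
the bonds b′ of the d-dimensional face of the fibre sums. [folklore] -/
theorem gradSq_other_part {ν μ : Fin (d + 1)} {μ' : Fin d} (hμ : ν.succAbove μ' = μ) (y : Fin (d + 1) → ℤ)
    (g : (Fin (d + 1) → ℤ) → ℝ) :
    ∑ b ∈ (bondsIn (lastLayer L y μ)).filter (fun b => ¬ b.2 = ν), (g (b.1 + unitVec b.2) - g b.1) ^ 2 =
      ∑ b' ∈ bondsIn (lastLayer L (rem ν y) μ'), ∑ a ∈ Ico (0 : ℤ) (L : ℤ),
        (g (ins ν (y ν + a) (b'.1 + unitVec b'.2)) - g (ins ν (y ν + a) b'.1)) ^ 2 := by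
  rw [← sum_product' (f := fun (b' : (Fin d → ℤ) × Fin d) (a : ℤ) =>
    (g (ins ν (y ν + a) (b'.1 + unitVec b'.2)) - g (ins ν (y ν + a) b'.1)) ^ 2)]
  symm
  refine sum_bij (fun q _ => (ins ν (y ν + q.2) q.1.1, ν.succAbove q.1.2)) ?_ ?_ ?_ ?_
  · intro q hq
    rw [mem_product, mem_bondsIn] at hq
    obtain ⟨⟨h1, h2⟩, h3⟩ := hq
    rw [mem_filter, mem_bondsIn]
    refine ⟨⟨(ins_mem_face_iff hμ).2 ⟨h1, h3⟩, ?_⟩, Fin.succAbove_ne ν q.1.2⟩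
    simp only
    rw [ins_add_unitVec_succAbove]
    exact (ins_mem_face_iff hμ).2 ⟨h2, h3⟩
  · intro q₁ _ q₂ _ h
    simp only [Prod.mk.injEq] at h
    obtain ⟨h1, h2⟩ := h
    have ha : q₁.2 = q₂.2 := by
      have := congrArg (fun x => x ν) h1
      simpa using this
    have hx : q₁.1.1 = q₂.1.1 := by
      have := congrArg (rem ν) h1
      simpa using this
    have hj : q₁.1.2 = q₂.1.2 := Fin.succAbove_right_injective h2
    ext <;> simp [ha, hx, hj]
  · intro b hb
    rw [mem_filter, mem_bondsIn] at hb
    obtain ⟨⟨h1, h2⟩, h3⟩ := hb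
    obtain ⟨j, hj⟩ := Fin.exists_succAbove_eq h3
    refine ⟨((rem ν b.1, j), b.1 ν - y ν), ?_, ?_⟩
    · rw [mem_product, mem_bondsIn]
      rw [mem_face_iff hμ] at h1
      have h2' : ins ν (y ν + (b.1 ν - y ν)) (rem ν b.1 + unitVec j) ∈ lastLayer L y μ := by
        rw [← ins_add_unitVec_succAbove, show y ν + (b.1 ν - y ν) = b.1 ν by ring, ins_rem, hj]
        exact h2
      rw [ins_mem_face_iff hμ] at h2'
      refine ⟨⟨h1.1, h2'.1⟩, mem_Ico.2 ⟨by omega, by omega⟩⟩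
    · simp only
      rw [show y ν + (b.1 ν - y ν) = b.1 ν by ring, ins_rem, hj]
  · intro q hq
    simp only
    rw [ins_add_unitVec_succAbove]

/-- The gradient form of the (d+1)-dimensional face splits along the fibration into the fibre path energies and
the fibre sums of the transverse bond differences. [folklore] -/
theorem gradSq_face_split {ν μ : Fin (d + 1)} {μ' : Fin d} (hμ : ν.succAbove μ' = μ) (y : Fin (d + 1) → ℤ)
    (g : (Fin (d + 1) → ℤ) → ℝ) :
    gradSq g (lastLayer L y μ) =
      ∑ x' ∈ lastLayer L (rem ν y) μ', ∑ a ∈ Ico (0 : ℤ) (L : ℤ),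
          (if a + 1 < (L : ℤ) then (g (ins ν (y ν + (a + 1)) x') - g (ins ν (y ν + a) x')) ^ 2 else 0) +
        ∑ b' ∈ bondsIn (lastLayer L (rem ν y) μ'), ∑ a ∈ Ico (0 : ℤ) (L : ℤ),
          (g (ins ν (y ν + a) (b'.1 + unitVec b'.2)) - g (ins ν (y ν + a) b'.1)) ^ 2 := by
  unfold gradSq
  rw [← sum_filter_add_sum_filter_not (bondsIn (lastLayer L y μ)) (fun b => b.2 = ν), gradSq_nu_part hμ,
    gradSq_other_part hμ]

/-! ## §5  The induction step -/

/-- Cauchy–Schwarz on a fibre: L · (fibre mean of t)² ≤ Σ t². [folklore] -/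
theorem mul_sq_avg_le (hL : 1 ≤ L) (t : ℤ → ℝ) :
    (L : ℝ) * ((∑ a ∈ Ico (0 : ℤ) (L : ℤ), t a) / (L : ℝ)) ^ 2 ≤ ∑ a ∈ Ico (0 : ℤ) (L : ℤ), t a ^ 2 := by
  have hL0 : (0 : ℝ) < L := by exact_mod_cast hL
  have hcs := sq_sum_le_card_mul_sum_sq (s := Ico (0 : ℤ) (L : ℤ)) (f := t)
  have hcard : (#(Ico (0 : ℤ) (L : ℤ)) : ℝ) = L := by
    rw [Int.card_Ico]; simp
  rw [hcard] at hcs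
  rw [div_pow, mul_div_assoc', div_le_iff₀ (by positivity)]
  nlinarith [hcs, hL0]

/-- There is a coordinate different from μ (d + 1 ≥ 2). [folklore] -/
theorem exists_ne_dir (hd : 1 ≤ d) (μ : Fin (d + 1)) : ∃ ν : Fin (d + 1), ν ≠ μ :=
  Fintype.exists_ne_of_one_lt_card (by rw [Fintype.card_fin]; omega) μ

/-- **The induction step.**  `ScaledIneq d L κ → PathIneq L κ → ScaledIneq (d+1) L κ` (d, L ≥ 1): fibre the
(d+1)-dimensional face over the d-dimensional one along a free coordinate ν ≠ μ; the fluctuation along the fibres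
is controlled by the path inequality, the fibre mean by the d-dimensional inequality, and the bond differences of
the fibre mean by those of g (Cauchy–Schwarz). [folklore] -/
theorem scaledIneq_succ (hd : 1 ≤ d) (hL : 1 ≤ L) {κ : ℝ} (hS : ScaledIneq d L κ) (hP : PathIneq L κ) :
    ScaledIneq (d + 1) L κ := by
  intro y μ g
  obtain ⟨ν, hνμ⟩ := exists_ne_dir hd μ
  obtain ⟨μ', hμ⟩ := Fin.exists_succAbove_eq hνμ.symm
  have hL0 : (0 : ℝ) < L := by exact_mod_cast hL
  have hLne : (L : ℝ) ≠ 0 := hL0.ne'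
  -- the fibre mean
  set A : (Fin d → ℤ) → ℝ := fun x' => (∑ a ∈ Ico (0 : ℤ) (L : ℤ), g (ins ν (y ν + a) x')) / (L : ℝ) with hA
  -- abbreviations
  set F' := lastLayer L (rem ν y) μ' with hF'
  set V : ℝ := ∑ x' ∈ F', ∑ a ∈ Ico (0 : ℤ) (L : ℤ), (g (ins ν (y ν + a) x') - A x') ^ 2 with hV
  set M : ℝ := ∑ x' ∈ F', A x' ^ 2 with hM
  set N : ℝ := ∑ x' ∈ F', ∑ a ∈ Ico (0 : ℤ) (L : ℤ),
      (if a + 1 < (L : ℤ) then (g (ins ν (y ν + (a + 1)) x') - g (ins ν (y ν + a) x')) ^ 2 else 0) with hN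
  set B : ℝ := ∑ b' ∈ bondsIn F', ∑ a ∈ Ico (0 : ℤ) (L : ℤ),
      (g (ins ν (y ν + a) (b'.1 + unitVec b'.2)) - g (ins ν (y ν + a) b'.1)) ^ 2 with hB
  set TA : ℝ := ∑ x' ∈ F', A x' with hTA
  -- (1) the face sums along the fibration
  have hT : ∑ x ∈ lastLayer L y μ, g x = (L : ℝ) * TA := by
    rw [sum_face_split hμ y g, hTA, mul_sum]
    refine sum_congr rfl fun x' _ => ?_
    rw [hA]; field_simp
  have hSq : ∑ x ∈ lastLayer L y μ, g x ^ 2 = V + (L : ℝ) * M := by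
    rw [sum_face_split hμ y (fun x => g x ^ 2), hV, hM, mul_sum, ← sum_add_distrib]
    refine sum_congr rfl fun x' _ => ?_
    exact sum_sq_eq_var_add L (fun a => g (ins ν (y ν + a) x')) (A x') (by rw [hA]; field_simp)
  have hG : gradSq g (lastLayer L y μ) = N + B := gradSq_face_split hμ y g
  -- (2) the fluctuation along the fibres: the path inequality
  have hVN : κ * V ≤ (L : ℝ) * N := by
    rw [hV, hN, mul_sum, mul_sum]
    refine sum_le_sum fun x' _ => ?_
    have := pathIneq_centered hP hL (fun a => g (ins ν (y ν + a) x'))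
    simpa only [hA] using this
  -- (3) the fibre mean: the d-dimensional inequality
  have hIH : κ * M ≤ (L : ℝ) * gradSq A F' + TA ^ 2 / (L : ℝ) ^ (d - 1) := hS (rem ν y) μ' A
  -- (4) the bond differences of the fibre mean: Cauchy–Schwarz
  have hJ : (L : ℝ) * gradSq A F' ≤ B := by
    rw [hB]; unfold gradSq; rw [mul_sum]
    refine sum_le_sum fun b' _ => ?_
    have e : A (b'.1 + unitVec b'.2) - A b'.1 = (∑ a ∈ Ico (0 : ℤ) (L : ℤ),
        (g (ins ν (y ν + a) (b'.1 + unitVec b'.2)) - g (ins ν (y ν + a) b'.1))) / (L : ℝ) := by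
      rw [hA]; simp only; rw [sum_sub_distrib, sub_div]
    rw [e]
    exact mul_sq_avg_le hL _
  -- (5) assembly
  have hM' : (L : ℝ) * (κ * M) ≤ (L : ℝ) * ((L : ℝ) * gradSq A F' + TA ^ 2 / (L : ℝ) ^ (d - 1)) :=
    mul_le_mul_of_nonneg_left hIH hL0.le
  have hJ' : (L : ℝ) * ((L : ℝ) * gradSq A F') ≤ (L : ℝ) * B := mul_le_mul_of_nonneg_left hJ hL0.le
  have hTT : (∑ x ∈ lastLayer L y μ, g x) ^ 2 / (L : ℝ) ^ (d + 1 - 1) =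
      (L : ℝ) * (TA ^ 2 / (L : ℝ) ^ (d - 1)) := by
    obtain ⟨k, rfl⟩ : ∃ k, d = k + 1 := ⟨d - 1, by omega⟩
    rw [hT, show k + 1 + 1 - 1 = k + 1 from rfl, show k + 1 - 1 = k from rfl]
    field_simp
    ring
  rw [hSq, hG, hTT]
  nlinarith [hVN, hM', hJ']

/-! ## §6  The layer sentence decided in every dimension -/

/-- `PathIneq L κ → ScaledIneq d L κ` for every d ≥ 2, L ≥ 1 (induction on d from `B6LayerDimTwo`). [folklore] -/
theorem scaledIneq_of_pathIneq (hd : 2 ≤ d) (hL : 1 ≤ L) {κ : ℝ} (hP : PathIneq L κ) : ScaledIneq d L κ := by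
  induction d, hd using Nat.le_induction with
  | base => exact (layerIneq_iff_scaled (by norm_num) hL κ).1 ((layerIneq_two_iff hL κ).2 hP)
  | succ n hn ih => exact scaledIneq_succ (by omega) hL ih hP

/-- `LayerIneq d L κ → κ ≤ 1` (d ≥ 2, L ≥ 1; constant test function). [folklore] -/
theorem kappa_le_one_of_layerIneq (hd : 2 ≤ d) (hL : 1 ≤ L) {κ : ℝ} (h : LayerIneq d L κ) : κ ≤ 1 := by
  have hS := (layerIneq_iff_scaled (by omega) hL κ).1 h (0 : Fin d → ℤ) ⟨0, by omega⟩ (fun _ => 1)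
  have hL0 : (0 : ℝ) < L := by exact_mod_cast hL
  have hcard : (#(lastLayer L (0 : Fin d → ℤ) (⟨0, by omega⟩ : Fin d)) : ℝ) = (L : ℝ) ^ (d - 1) := by
    rw [B6LayerPoincare.card_lastLayer hL]; push_cast; rfl
  have hgrad : gradSq (fun _ => (1 : ℝ)) (lastLayer L (0 : Fin d → ℤ) (⟨0, by omega⟩ : Fin d)) = 0 := by
    unfold gradSq; simp
  simp only [one_pow, sum_const, nsmul_eq_mul, mul_one, hgrad, mul_zero, zero_add] at hS
  rw [hcard] at hS
  have hpos : (0 : ℝ) < (L : ℝ) ^ (d - 1) := by positivity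
  rw [pow_two, mul_div_assoc, div_self hpos.ne', mul_one] at hS
  nlinarith

/-- `LayerIneq d L κ → PathIneq L κ` (d ≥ 2, L ≥ 1): the profile test functions of `B6LayerRayleigh` give the
centred part, the constant test function the mean part. [folklore] -/
theorem pathIneq_of_layerIneq (hd : 2 ≤ d) (hL : 1 ≤ L) {κ : ℝ} (h : LayerIneq d L κ) : PathIneq L κ := by
  intro u
  have hL0 : (0 : ℝ) < L := by exact_mod_cast hL
  have hLne : (L : ℝ) ≠ 0 := hL0.ne'
  have hκ := kappa_le_one_of_layerIneq hd hL h
  set m : ℝ := (∑ a ∈ Ico (0 : ℤ) (L : ℤ), u a) / (L : ℝ) with hm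
  have hsum : ∑ a ∈ Ico (0 : ℤ) (L : ℤ), (u a - m) = 0 := by
    rw [sum_sub_distrib, sum_Ico_const, hm, mul_div_cancel₀ _ hLne, sub_self]
  have hray := layerIneq_rayleigh hd hL (fun a => u a - m) hsum h
  have hdiff : ∀ a : ℤ, (if a + 1 < (L : ℤ) then (u (a + 1) - m - (u a - m)) ^ 2 else 0) =
      (if a + 1 < (L : ℤ) then (u (a + 1) - u a) ^ 2 else 0) := fun a => by
    split_ifs
    · ring
    · rfl
  simp only [hdiff] at hray
  have hvar := sum_sq_eq_var_add L u m (by rw [hm]; field_simp)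
  have hT : (∑ a ∈ Ico (0 : ℤ) (L : ℤ), u a) ^ 2 / (L : ℝ) = (L : ℝ) * m ^ 2 := by
    rw [hm]; field_simp
  rw [hvar, hT]
  have hm2 : 0 ≤ (L : ℝ) * m ^ 2 := by positivity
  nlinarith [hray, hκ, hm2]

/-- **The layer inequality is one-dimensional.**  For every d ≥ 2, L ≥ 1 and κ: `LayerIneq d L κ ↔ PathIneq L κ`.
[folklore] -/
theorem layerIneq_iff_pathIneq (hd : 2 ≤ d) (hL : 1 ≤ L) (κ : ℝ) : LayerIneq d L κ ↔ PathIneq L κ :=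
  ⟨pathIneq_of_layerIneq hd hL,
    fun hP => (layerIneq_iff_scaled (by omega) hL κ).2 (scaledIneq_of_pathIneq hd hL hP)⟩

/-- Dimension independence: `LayerIneq d L κ ↔ LayerIneq 2 L κ` (d ≥ 2). [folklore] -/
theorem layerIneq_iff_two (hd : 2 ≤ d) (κ : ℝ) : LayerIneq d L κ ↔ LayerIneq 2 L κ := by
  rcases Nat.eq_zero_or_pos L with rfl | hL
  · exact ⟨fun _ => layerIneq_len_zero κ, fun _ => layerIneq_len_zero κ⟩
  · rw [layerIneq_iff_pathIneq hd hL, layerIneq_two_iff hL]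

/-- **The printed factor 1 decided in every dimension:** for d ≥ 2 and every L, `LayerIneq d L 1 ↔ L ≤ 9`.
[folklore] -/
theorem layerIneq_one_iff (hd : 2 ≤ d) : LayerIneq d L 1 ↔ L ≤ 9 := by
  rw [layerIneq_iff_two hd, layerIneq_two_one_iff]

/-- Every κ ≤ 1 is admissible for L ≤ 9, in every dimension d ≥ 2. [folklore] -/
theorem layerIneq_of_le_nine (hd : 2 ≤ d) (hL : L ≤ 9) {κ : ℝ} (hκ : κ ≤ 1) : LayerIneq d L κ :=
  ((layerIneq_one_iff hd).2 hL).mono hκ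

/-- … and no κ ≥ 1 is admissible for L ≥ 10 (`B6LayerRayleigh`), so the set of admissible (L, κ) with κ = 1 is
exactly L ≤ 9: restated as a single equivalence. [folklore] -/
theorem layerIneq_one_iff' (hd : 2 ≤ d) : LayerIneq d L 1 ↔ ¬ 10 ≤ L := by
  rw [layerIneq_one_iff hd]; omega

end Literature.MathematicalPhysics.QuantumFieldTheory.Balaban1983to89.B6LayerTensor
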